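import Literature.AlgebraicGeometry.Hu2025.Proofs.S04ModelV.GoverningPlatform
import Literature.AlgebraicGeometry.Hu2025.Proofs.S04ModelV.Lem48Platform
import HarnessLib

/-!
# Hu 2025 §4.1 / §4.2.1 AT THE PLATFORM INSTANTIATION (rows 101/102/105c: `relN`, `monoN`, `headN`, `rkPrimary`,
# `primaryTerms`): convention (4.1) `Eq4_1` and Lem. 4.8 ‹chunk Lem. 4.7› `Lem4_8` DISCHARGED for every `n`
# (`Eq4_1N_holds`, `Lem4_8N_holds`); file `Proofs/S04ModelV/Lem48PlatformN.lean`, typer of record res-type-042 (row 103)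

**HONEST FRAMING (D-0012/D-0089).** Theorems about OUR typed renderings (row 103 generic carrier instantiated at the
row-101/102/105 data of res-type-009 / res-type-079); the preprint [Hu2025] (arXiv:2507.21400v1) stays «under review»;
nothing of it is asserted; AI proof is weaker than expert review.

* `Lem4_8N_holds` — Lem. 4.8 at the platform, every `n`, every commutative `k`, every `Φ`: `Lem4_8_ours_holds` (file
  `Lem48Platform`) fed with the platform facts of `GoverningPlatform` (res-type-079): `relN_headN` (hhead),
  `monoN_headN` (H1: `x̄_{s_F} = x_{u_F}`), `uF_notMem_support_monoN_of_rk_one` (H2: for rank-one `F`, `x_{(abc)}` occurs in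
  no other chart monomial).
* `Eq4_1N_holds` — convention (4.1): the ϱ-variables of each `ℙ_F` are named unambiguously by the UNORDERED pairs
  `{u_s, v_s}` (`primaryTerms_pairs_nodup` via `Sym2.eq_iff`; `four_le_snd_of_isLt`).
-/

noncomputable section

namespace Literature.AlgebraicGeometry.Hu2025.Statements.S04ModelV
open Literature.AlgebraicGeometry.Hu2025.Statements.S03Pluecker
open Literature.AlgebraicGeometry.Hu2025.Proofs.S04ModelV

/-- **Lem. 4.8 AT THE PLATFORM** (`n` arbitrary, any commutative `k`, any `Φ`): the generic `Lem4_8` instantiated at the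
row-101/102/105 data (`relN`, `monoN`, `rkPrimary`, `headN`) HOLDS — from `Lem4_8_ours_holds` and res-type-079's platform
facts `relN_headN` (hhead), `monoN_headN` (H1), `uF_notMem_support_monoN_of_rk_one` (H2).
[cite: Hu2025, §4.1 (4.1) / §4.2.1 Lem. 4.8 ‹chunk Lem. 4.7›, chunks p0021 l.22–30 / p0022 l.74–106, pp. 44, 48 (unrefereed preprint arXiv:2507.21400v1 under adjudication, D-0012/D-0089 — kernel support on OUR typed renderings of row 103 at the platform instantiation; nothing of the source asserted)] -/
theorem Lem4_8N_holds (n : ℕ) (k : Type) [CommRing k] (Φ : Set (RelIdx n)) :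
    Lem4_8 (k := k) (relN n) (monoN n) (fun F : RelIdx n => rkPrimary F.1.1) (headN n) Φ := by
  classical
  exact Lem4_8_ours_holds (k := k) (relN n) (monoN n) (fun F : RelIdx n => rkPrimary F.1.1) (headN n) Φ
    (fun F => ⟨F.1.1, mem_plVarSet_of_relIdx n F⟩) (fun F => relN_headN n F) (fun F _ => monoN_headN n F)
    (fun F hrk t ht => uF_notMem_support_monoN_of_rk_one n F hrk t ht)

/-- Convention (4.1) at the platform, per relation: the term list of `F̄_{m,u}` has pairwise distinct UNORDERED index pairs
`{u_s, v_s}` (for `u` with `4 ≤ u.2.1 < u.2.2`, which holds on `𝕀^lt_{3,n}`).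
[cite: Hu2025, §4.1 (4.1) / §4.2.1 Lem. 4.8 ‹chunk Lem. 4.7›, chunks p0021 l.22–30 / p0022 l.74–106, pp. 44, 48 (unrefereed preprint arXiv:2507.21400v1 under adjudication, D-0012/D-0089 — kernel support on OUR typed renderings of row 103 at the platform instantiation; nothing of the source asserted)] -/
theorem primaryTerms_pairs_nodup (u : ℕ × ℕ × ℕ) (hu : IsLt u) (h23 : u.2.1 < u.2.2) (hu4 : 4 ≤ u.2.1) :
    ((primaryTerms u).map fun t : PlTerm => s(t.us, t.vs)).Nodup := by
  unfold primaryTerms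
  rw [if_pos hu]
  have hm : mTri = (1, 2, 3) := rfl
  split_ifs with ha hb hc <;>
    simp only [List.map_cons, List.map_nil, List.nodup_cons, List.mem_cons, List.not_mem_nil, List.nodup_nil,
      Sym2.eq_iff, Prod.mk.injEq, hm, or_false, not_or, and_true, not_false_eq_true, true_and] <;>
    omega

/-- On `𝕀^lt_{3,n}` the middle index is `≥ 4` (two of the three increasing indices lie outside `{1,2,3}`).
[cite: Hu2025, §4.1 (4.1) / §4.2.1 Lem. 4.8 ‹chunk Lem. 4.7›, chunks p0021 l.22–30 / p0022 l.74–106, pp. 44, 48 (unrefereed preprint arXiv:2507.21400v1 under adjudication, D-0012/D-0089 — kernel support on OUR typed renderings of row 103 at the platform instantiation; nothing of the source asserted)] -/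
theorem four_le_snd_of_isLt (u : ℕ × ℕ × ℕ) (hu : IsLt u) (h12 : u.1 < u.2.1) (h23 : u.2.1 < u.2.2) (h1 : 1 ≤ u.1) :
    4 ≤ u.2.1 := by
  by_contra hlt
  have hsub : triSet u \ mSet ⊆ {u.2.2} := by
    intro x hx
    simp only [triSet, mSet, Finset.mem_sdiff, Finset.mem_insert, Finset.mem_singleton] at hx ⊢
    omega
  have hcard := Finset.card_le_card hsub
  rw [Finset.card_singleton] at hcard
  unfold IsLt at hu
  omega

/-- **Convention (4.1) HOLDS at the platform instantiation**: the ϱ-variables of one `ℙ_F` are unambiguously named by the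
UNORDERED pairs `{u_s, v_s}` — `Eq4_1 (relN n) (termN · |>.us, ·.vs)`.
[cite: Hu2025, §4.1 (4.1) / §4.2.1 Lem. 4.8 ‹chunk Lem. 4.7›, chunks p0021 l.22–30 / p0022 l.74–106, pp. 44, 48 (unrefereed preprint arXiv:2507.21400v1 under adjudication, D-0012/D-0089 — kernel support on OUR typed renderings of row 103 at the platform instantiation; nothing of the source asserted)] -/
theorem Eq4_1N_holds (n : ℕ) :
    Eq4_1 (T := TermIdx n) (relN n) (fun t => ((termN t).us, (termN t).vs)) := by
  rintro ⟨G₁, j₁⟩ ⟨G₂, j₂⟩ h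
  simp only [relN, Prod.mk.injEq] at h
  obtain ⟨hG, hs⟩ := h
  subst hG
  -- indices of G₁ are increasing with middle index ≥ 4
  have hmem := G₁.1.2
  unfold plIndexSet at hmem
  simp only [Finset.mem_filter, Finset.mem_product, Finset.mem_Icc] at hmem
  have h4 : 4 ≤ G₁.1.1.2.1 := four_le_snd_of_isLt G₁.1.1 G₁.2 hmem.2.1 hmem.2.2 hmem.1.1.1
  have hnd := primaryTerms_pairs_nodup G₁.1.1 G₁.2 hmem.2.2 h4
  rw [List.nodup_iff_injective_get] at hnd
  have hlen : ((primaryTerms G₁.1.1).map fun t : PlTerm => s(t.us, t.vs)).length = (primaryTerms G₁.1.1).length :=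
    List.length_map _
  have key : (Fin.cast hlen.symm j₁) = (Fin.cast hlen.symm j₂) := by
    apply hnd
    simp only [List.get_eq_getElem, Fin.val_cast, List.getElem_map]
    unfold termN at hs
    simpa [List.get_eq_getElem] using hs
  have hj : j₁ = j₂ := by
    have := congrArg Fin.val key
    simp only [Fin.val_cast] at this
    exact Fin.ext this
  subst hj
  rfl

end Literature.AlgebraicGeometry.Hu2025.Statements.S04ModelV

end
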